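import Summits.KontsevichZagierPeriods.Zeta5Search.SymRayRecurrence
import Summits.KontsevichZagierPeriods.Zeta5Search.SymRayContiguity
import HarnessLib

/-!
# The partner contiguity on the symmetric ray: bookkeeping and the rational identity (cell `pub-zeta5`, P1)

HONEST FRAMING: systematic search; no irrationality claim unless certified.

OUR work (Summit side), P1 seat generation 3. From the kernel-certified certificate identity
`SymRayContiguity.gosper_contig_symray` (`(κN' − αD₂ − βN₁ − γN₂)·B₂ = y(·,t+1)A₂ − y·B₂`) we derive the rational identity

  `κ(n)R'_n(t) − α(n)R_n(t) − β(n)R_{n+1}(t) − γ(n)R_{n+2}(t) + H(t) − H(t+1) = 0`   (`t ∈ ℕ`; `contig_identity_ray`)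

for the summands `R_m` of the ray `b_m = (3m;m⁷)`, the partner `R'_n = (t+n+1)(t+2n+1)R_n` (`b'_n = b_n + e₁`) and the certificate
`H = y·R_n/D₂`, whose partial fractions EXIST with lattice poles of order `≤ 7` (`exists_pf_H`; `H·((t+1)_{3n+5})⁷` is a polynomial of
degree `≤ 17n+34`) and which vanishes at `t = 0` (`y(n,0) = 0`). All six terms are put over the common factor
`R̄₂ = (t+1)_n(t+2n+2)_n/((t+n+1)_{n+1}⁶((t+2n+2)⋯(t+2n+6))⁷(t+1))`. The transfer to `U, W, V` is in `SymRayContigRelations.lean`.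
-/

noncomputable section

open Finset Polynomial

namespace Summit.KontsevichZagierPeriods.Zeta5Search.SymRay

open Summit.KontsevichZagierPeriods.Zeta5Search.DualSeries
open Summit.KontsevichZagierPeriods.Zeta5Search.WedgeDictionary
open Summit.KontsevichZagierPeriods.Zeta5Search.PolyReflect
open Literature.NumberTheory.Transcendental
open Literature.NumberTheory.Transcendental.BallRivoal (pfEval pf_unique poch_pos harm pochPoly eval_pochPoly)
open Literature.NumberTheory.Irrationality.CressonFischlerRivoal2008 (exists_pf_data)

/-! ### The certificate `H` as a polynomial over the lattice denominator -/

/-- `H·((t+1)_{3n+5})⁷ = y(n,t)·(t+1)_n⁸ (t+2n+2)_n (t+n+1)_{n+1} (t+2n+6)_n⁷` as a polynomial in `t`. -/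
def hPolyT (n : ℕ) : ℚ[X] :=
  toPolyT yCert n * (pochPoly 1 n ^ 8 * pochPoly (2 * n + 2) n * pochPoly (n + 1) (n + 1) * pochPoly (2 * n + 6) n ^ 7)

/-- Evaluation of `hPolyT`. -/
theorem eval_hPolyT (n : ℕ) (t : ℚ) : (hPolyT n).eval t =
    ev2 yCert n t * (BallRivoal.poch (t + 1) n ^ 8 * BallRivoal.poch (t + (2 * n + 2)) n *
      BallRivoal.poch (t + (n + 1)) (n + 1) * BallRivoal.poch (t + (2 * n + 6)) n ^ 7) := by
  simp only [hPolyT, eval_mul, eval_pow, eval_toPolyT, eval_pochPoly]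

/-- `yCert` has `33` rows. -/
theorem yCert_length : yCert.length = 33 := by decide

/-- `deg hPolyT ≤ 17n + 34 (< 7(3n+5))`. -/
theorem natDegree_hPolyT_le (n : ℕ) : (hPolyT n).natDegree ≤ 17 * n + 34 := by
  unfold hPolyT
  have h0 := natDegree_toPolyT_le yCert (n : ℚ)
  rw [yCert_length] at h0
  have h1 := natDegree_pochPoly_le (1 : ℚ) n
  have h2 := natDegree_pochPoly_le ((2 * n + 2 : ℕ) : ℚ) n
  have h3 := natDegree_pochPoly_le ((n + 1 : ℕ) : ℚ) (n + 1)
  have h4 := natDegree_pochPoly_le ((2 * n + 6 : ℕ) : ℚ) n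
  have e1 : (pochPoly 1 n ^ 8).natDegree ≤ 8 * n := natDegree_pow_le.trans (by omega)
  have e4 : (pochPoly ((2 * n + 6 : ℕ) : ℚ) n ^ 7).natDegree ≤ 7 * n := natDegree_pow_le.trans (by omega)
  push_cast at h2 h3 h4 e4
  refine natDegree_mul_le.trans ?_
  have e5 := natDegree_mul_le (p := pochPoly 1 n ^ 8 * pochPoly (2 * n + 2) n * pochPoly (n + 1) (n + 1))
    (q := pochPoly (2 * (n : ℚ) + 6) n ^ 7)
  have e6 := natDegree_mul_le (p := pochPoly 1 n ^ 8 * pochPoly (2 * (n : ℚ) + 2) n) (q := pochPoly ((n : ℚ) + 1) (n + 1))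
  have e7 := natDegree_mul_le (p := pochPoly (1 : ℚ) n ^ 8) (q := pochPoly (2 * (n : ℚ) + 2) n)
  omega

/-- **Partial fractions of the certificate `H` exist** (lattice poles `−1, …, −(3n+5)` of order `≤ 7`). -/
theorem exists_pf_H (n : ℕ) : ∃ d : ℕ → ℕ → ℚ, ∀ t : ℚ, (∀ p, p ≤ 3 * n + 4 → t + p + 1 ≠ 0) →
    pfEval (3 * n + 4) 7 d t = (hPolyT n).eval t / BallRivoal.poch (t + 1) (3 * n + 5) ^ 7 := by
  have hdeg : (hPolyT n).degree < ((7 * (3 * n + 4 + 1) : ℕ) : WithBot ℕ) :=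
    (degree_le_of_natDegree_le (natDegree_hPolyT_le n)).trans_lt (by exact_mod_cast (by omega))
  obtain ⟨d, hd⟩ := exists_pf_data (3 * n + 4) 7 (by norm_num) (hPolyT n) hdeg
  exact ⟨d, fun t ht => by rw [hd t ht]⟩

/-- `y(n,0) = 0`: the row `t^0` of the certificate is zero, so `H(0) = 0`. -/
theorem ev2_yCert_zero (n : ℚ) : ev2 yCert n 0 = 0 := by
  rw [show yCert = [0] :: (yCertA.tail ++ yCertB) from rfl, ev2_cons]
  simp

/-! ### Pochhammer bookkeeping (atoms as in `SymRayRecurrence`) -/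

section atoms
variable (n t : ℚ)
/-- `t+n+1`. -/
private theorem l111 : ev2 (lin2 1 1 1) n t = t + n + 1 := by rw [ev2_lin2]; push_cast; ring
/-- `t+n+2`. -/
private theorem l112 : ev2 (lin2 1 1 2) n t = t + n + 2 := by rw [ev2_lin2]; push_cast; ring
/-- `t+2n+j`. -/
private theorem l21 (j : ℤ) : ev2 (lin2 2 1 j) n t = t + 2 * n + j := by rw [ev2_lin2]; push_cast; ring
/-- `t+3n+j`. -/
private theorem l31 (j : ℤ) : ev2 (lin2 3 1 j) n t = t + 3 * n + j := by rw [ev2_lin2]; push_cast; ring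
/-- `2t+3n+j`. -/
private theorem l32 (j : ℤ) : ev2 (lin2 3 2 j) n t = 2 * t + 3 * n + j := by rw [ev2_lin2]; push_cast; ring
/-- `t+1`. -/
private theorem l011 : ev2 (lin2 0 1 1) n t = t + 1 := by rw [ev2_lin2]; push_cast; ring
end atoms

/-- `(x)_2`. -/
private theorem poch_two' (x : ℚ) : BallRivoal.poch x 2 = x * (x + 1) := by
  simp [BallRivoal.poch, prod_range_succ]
/-- `(x)_3`. -/
private theorem poch_three' (x : ℚ) : BallRivoal.poch x 3 = x * (x + 1) * (x + 2) := by
  simp [BallRivoal.poch, prod_range_succ]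
/-- `(x)_4`. -/
private theorem poch_four' (x : ℚ) : BallRivoal.poch x 4 = x * (x + 1) * (x + 2) * (x + 3) := by
  simp [BallRivoal.poch, prod_range_succ]
/-- `(x)_5`. -/
private theorem poch_five' (x : ℚ) : BallRivoal.poch x 5 = x * (x + 1) * (x + 2) * (x + 3) * (x + 4) := by
  simp [BallRivoal.poch, prod_range_succ]
/-- `(x)_6`. -/
private theorem poch_six' (x : ℚ) :
    BallRivoal.poch x 6 = x * (x + 1) * (x + 2) * (x + 3) * (x + 4) * (x + 5) := by
  simp [BallRivoal.poch, prod_range_succ]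

/-- The common factor `R̄₂ = (t+1)_n (t+2n+2)_n / ((t+n+1)_{n+1}⁶ ((t+2n+2)⋯(t+2n+6))⁷ (t+1))`. -/
def Rbar2 (n t : ℚ) (k : ℕ) : ℚ :=
  BallRivoal.poch (t + 1) k * BallRivoal.poch (t + 2 * n + 2) k /
    (BallRivoal.poch (t + n + 1) (k + 1) ^ 6 *
      (ev2 (lin2 2 1 2) n t * ev2 (lin2 2 1 3) n t * ev2 (lin2 2 1 4) n t * ev2 (lin2 2 1 5) n t *
        ev2 (lin2 2 1 6) n t) ^ 7 * ev2 (lin2 0 1 1) n t)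

/-- `R_n = R̄₂·D₂·B₂`. -/
theorem cterm0 (n t : ℕ) : pfEval (3 * n) 6 (pfData (bRay n)) t = Rbar2 n t n * (ev2 cD2 n t * ev2 cB2 n t) := by
  have ht : ∀ p, p ≤ 3 * n → (t : ℚ) + p + 1 ≠ 0 := fun p _ => by positivity
  rw [pfEval_ray n t ht, poch_ray_split]
  simp only [Rbar2, cD2, cB2, ev2_mul2, ev2_pow2, l21, l32, l011]
  have hA : BallRivoal.poch ((t : ℚ) + 1) n ≠ 0 := (poch_pos (by positivity) _).ne'
  have hC : BallRivoal.poch ((t : ℚ) + 2 * n + 2) n ≠ 0 := (poch_pos (by positivity) _).ne'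
  have hE : BallRivoal.poch ((t : ℚ) + n + 1) (n + 1) ≠ 0 := (poch_pos (by positivity) _).ne'
  push_cast
  field_simp

/-- `R'_n = R̄₂·N'·B₂`. -/
theorem ctermP (n t : ℕ) : pfEval (3 * n) 6 (pfData (bRay' n)) t = Rbar2 n t n * (ev2 cNp n t * ev2 cB2 n t) := by
  have ht : ∀ p, p ≤ 3 * n → (t : ℚ) + p + 1 ≠ 0 := fun p _ => by positivity
  rw [pfEval_ray' n t ht, poch_ray_split]
  simp only [Rbar2, cNp, cD2, cB2, ev2_mul2, ev2_pow2, l111, l21, l32, l011]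
  have hA : BallRivoal.poch ((t : ℚ) + 1) n ≠ 0 := (poch_pos (by positivity) _).ne'
  have hC : BallRivoal.poch ((t : ℚ) + 2 * n + 2) n ≠ 0 := (poch_pos (by positivity) _).ne'
  have hE : BallRivoal.poch ((t : ℚ) + n + 1) (n + 1) ≠ 0 := (poch_pos (by positivity) _).ne'
  push_cast
  field_simp

/-- `R_{n+1} = R̄₂·N₁·B₂`. -/
theorem cterm1 (n t : ℕ) :
    pfEval (3 * (n + 1)) 6 (pfData (bRay (n + 1))) t = Rbar2 n t n * (ev2 cN1 n t * ev2 cB2 n t) := by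
  have ht : ∀ p, p ≤ 3 * (n + 1) → (t : ℚ) + p + 1 ≠ 0 := fun p _ => by positivity
  rw [pfEval_ray (n + 1) t ht, poch_ray_split]
  set A := BallRivoal.poch ((t : ℚ) + 1) n with hAdef
  set C := BallRivoal.poch ((t : ℚ) + 2 * n + 2) n with hCdef
  set E := BallRivoal.poch ((t : ℚ) + n + 1) (n + 1) with hEdef
  have e1 : BallRivoal.poch ((t : ℚ) + 1) (n + 1) = A * ((t : ℚ) + n + 1) := by rw [hAdef, poch_succ_right]; ring
  have e2 : BallRivoal.poch ((t : ℚ) + 2 * ((n + 1 : ℕ) : ℚ) + 2) (n + 1) * (((t : ℚ) + 2 * n + 2) * ((t : ℚ) + 2 * n + 3)) =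
      C * (((t : ℚ) + 3 * n + 2) * ((t : ℚ) + 3 * n + 3) * ((t : ℚ) + 3 * n + 4)) := by
    have h := poch_split_comm ((t : ℚ) + 2 * n + 2) (a := 2) (b := n + 1) (c := n) (d := 3) (by ring)
    rw [poch_two', poch_three', ← hCdef] at h
    have : BallRivoal.poch ((t : ℚ) + 2 * ((n + 1 : ℕ) : ℚ) + 2) (n + 1) =
        BallRivoal.poch ((t : ℚ) + 2 * n + 2 + (2 : ℕ)) (n + 1) := by congr 1; push_cast; ring
    rw [this]; push_cast at h ⊢; linear_combination h
  have e3 : BallRivoal.poch ((t : ℚ) + ((n + 1 : ℕ) : ℚ) + 1) (n + 1 + 1) * ((t : ℚ) + n + 1) =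
      E * (((t : ℚ) + 2 * n + 2) * ((t : ℚ) + 2 * n + 3)) := by
    have h := poch_split_comm ((t : ℚ) + n + 1) (a := 1) (b := n + 2) (c := n + 1) (d := 2) (by ring)
    rw [poch_two', ← hEdef, show BallRivoal.poch ((t : ℚ) + n + 1) 1 = (t : ℚ) + n + 1 by
      simp [BallRivoal.poch]] at h
    have : BallRivoal.poch ((t : ℚ) + ((n + 1 : ℕ) : ℚ) + 1) (n + 1 + 1) =
        BallRivoal.poch ((t : ℚ) + n + 1 + ((1 : ℕ) : ℚ)) (n + 2) := by congr 1; push_cast; ring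
    rw [this]; push_cast at h ⊢; linear_combination h
  simp only [Rbar2, cN1, cB2, ev2_mul2, ev2_pow2, l111, l21, l31, l32, l011]
  rw [← hAdef, ← hCdef, ← hEdef]
  have hA : A ≠ 0 := (poch_pos (by positivity) _).ne'
  have hC : C ≠ 0 := (poch_pos (by positivity) _).ne'
  have hE : E ≠ 0 := (poch_pos (by positivity) _).ne'
  have hv : ((t : ℚ) + 2 * n + 2) * ((t : ℚ) + 2 * n + 3) ≠ 0 := by positivity
  have hu : ((t : ℚ) + n + 1) ≠ 0 := by positivity
  rw [e1, (eq_div_iff hv).2 e2, (eq_div_iff hu).2 e3]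
  push_cast
  field_simp
  ring

/-- `R_{n+2} = R̄₂·N₂·B₂`. -/
theorem cterm2 (n t : ℕ) :
    pfEval (3 * (n + 2)) 6 (pfData (bRay (n + 2))) t = Rbar2 n t n * (ev2 cN2 n t * ev2 cB2 n t) := by
  have ht : ∀ p, p ≤ 3 * (n + 2) → (t : ℚ) + p + 1 ≠ 0 := fun p _ => by positivity
  rw [pfEval_ray (n + 2) t ht, poch_ray_split]
  set A := BallRivoal.poch ((t : ℚ) + 1) n with hAdef
  set C := BallRivoal.poch ((t : ℚ) + 2 * n + 2) n with hCdef
  set E := BallRivoal.poch ((t : ℚ) + n + 1) (n + 1) with hEdef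
  have e1 : BallRivoal.poch ((t : ℚ) + 1) (n + 2) = A * (((t : ℚ) + n + 1) * ((t : ℚ) + n + 2)) := by
    rw [hAdef, poch_add, poch_two']; ring
  have e2 : BallRivoal.poch ((t : ℚ) + 2 * ((n + 2 : ℕ) : ℚ) + 2) (n + 2) *
      (((t : ℚ) + 2 * n + 2) * ((t : ℚ) + 2 * n + 3) * ((t : ℚ) + 2 * n + 4) * ((t : ℚ) + 2 * n + 5)) =
      C * (((t : ℚ) + 3 * n + 2) * ((t : ℚ) + 3 * n + 3) * ((t : ℚ) + 3 * n + 4) * ((t : ℚ) + 3 * n + 5) *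
        ((t : ℚ) + 3 * n + 6) * ((t : ℚ) + 3 * n + 7)) := by
    have h := poch_split_comm ((t : ℚ) + 2 * n + 2) (a := 4) (b := n + 2) (c := n) (d := 6) (by ring)
    rw [poch_four', poch_six', ← hCdef] at h
    have : BallRivoal.poch ((t : ℚ) + 2 * ((n + 2 : ℕ) : ℚ) + 2) (n + 2) =
        BallRivoal.poch ((t : ℚ) + 2 * n + 2 + (4 : ℕ)) (n + 2) := by congr 1; push_cast; ring
    rw [this]; push_cast at h ⊢; linear_combination h
  have e3 : BallRivoal.poch ((t : ℚ) + ((n + 2 : ℕ) : ℚ) + 1) (n + 2 + 1) * (((t : ℚ) + n + 1) * ((t : ℚ) + n + 2)) =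
      E * (((t : ℚ) + 2 * n + 2) * ((t : ℚ) + 2 * n + 3) * ((t : ℚ) + 2 * n + 4) * ((t : ℚ) + 2 * n + 5)) := by
    have h := poch_split_comm ((t : ℚ) + n + 1) (a := 2) (b := n + 3) (c := n + 1) (d := 4) (by ring)
    rw [poch_two', poch_four', ← hEdef] at h
    have : BallRivoal.poch ((t : ℚ) + ((n + 2 : ℕ) : ℚ) + 1) (n + 2 + 1) =
        BallRivoal.poch ((t : ℚ) + n + 1 + (2 : ℕ)) (n + 3) := by congr 1; push_cast; ring
    rw [this]; push_cast at h ⊢; linear_combination h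
  simp only [Rbar2, cN2, cB2, ev2_mul2, ev2_pow2, l111, l112, l21, l31, l32, l011]
  rw [← hAdef, ← hCdef, ← hEdef]
  have hA : A ≠ 0 := (poch_pos (by positivity) _).ne'
  have hC : C ≠ 0 := (poch_pos (by positivity) _).ne'
  have hE : E ≠ 0 := (poch_pos (by positivity) _).ne'
  have hv : ((t : ℚ) + 2 * n + 2) * ((t : ℚ) + 2 * n + 3) * ((t : ℚ) + 2 * n + 4) * ((t : ℚ) + 2 * n + 5) ≠ 0 := by
    positivity
  have hu : ((t : ℚ) + n + 1) * ((t : ℚ) + n + 2) ≠ 0 := by positivity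
  rw [e1, (eq_div_iff hv).2 e2, (eq_div_iff hu).2 e3]
  push_cast
  field_simp
  ring

/-- `H(t) = R̄₂·y(n,t)·B₂` for partial-fraction data `d` of `H`. -/
theorem ctermH (n t : ℕ) (d : ℕ → ℕ → ℚ)
    (hd : ∀ s : ℚ, (∀ p, p ≤ 3 * n + 4 → s + p + 1 ≠ 0) →
      pfEval (3 * n + 4) 7 d s = (hPolyT n).eval s / BallRivoal.poch (s + 1) (3 * n + 5) ^ 7) :
    pfEval (3 * n + 4) 7 d t = Rbar2 n t n * (ev2 yCert n t * ev2 cB2 n t) := by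
  rw [hd _ (fun p _ => by positivity), eval_hPolyT]
  set A := BallRivoal.poch ((t : ℚ) + 1) n with hAdef
  set C := BallRivoal.poch ((t : ℚ) + 2 * n + 2) n with hCdef
  set E := BallRivoal.poch ((t : ℚ) + n + 1) (n + 1) with hEdef
  have eC : BallRivoal.poch ((t : ℚ) + (2 * n + 2)) n = C := by rw [hCdef]; congr 1; ring
  have eE : BallRivoal.poch ((t : ℚ) + (n + 1)) (n + 1) = E := by rw [hEdef]; congr 1; ring
  have e4 : BallRivoal.poch ((t : ℚ) + (2 * n + 6)) n *
      (((t : ℚ) + 2 * n + 2) * ((t : ℚ) + 2 * n + 3) * ((t : ℚ) + 2 * n + 4) * ((t : ℚ) + 2 * n + 5)) =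
      C * (((t : ℚ) + 3 * n + 2) * ((t : ℚ) + 3 * n + 3) * ((t : ℚ) + 3 * n + 4) * ((t : ℚ) + 3 * n + 5)) := by
    have h := poch_split_comm ((t : ℚ) + 2 * n + 2) (a := 4) (b := n) (c := n) (d := 4) (by ring)
    rw [poch_four', poch_four', ← hCdef] at h
    have : BallRivoal.poch ((t : ℚ) + (2 * n + 6)) n = BallRivoal.poch ((t : ℚ) + 2 * n + 2 + (4 : ℕ)) n := by
      congr 1; push_cast; ring
    rw [this]; push_cast at h ⊢; linear_combination h
  have e5 : BallRivoal.poch ((t : ℚ) + 1) (3 * n + 5) =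
      A * E * C * (((t : ℚ) + 3 * n + 2) * ((t : ℚ) + 3 * n + 3) * ((t : ℚ) + 3 * n + 4) * ((t : ℚ) + 3 * n + 5)) := by
    rw [show 3 * n + 5 = (3 * n + 1) + 4 by ring, poch_add, poch_ray_split, poch_four', ← hAdef, ← hCdef, ← hEdef]
    push_cast; ring
  simp only [Rbar2, cB2, ev2_mul2, ev2_pow2, l21, l011]
  rw [← hAdef, ← hCdef, ← hEdef]
  have hA : A ≠ 0 := (poch_pos (by positivity) _).ne'
  have hC : C ≠ 0 := (poch_pos (by positivity) _).ne'
  have hE : E ≠ 0 := (poch_pos (by positivity) _).ne'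
  have hv : ((t : ℚ) + 2 * n + 2) * ((t : ℚ) + 2 * n + 3) * ((t : ℚ) + 2 * n + 4) * ((t : ℚ) + 2 * n + 5) ≠ 0 := by
    positivity
  rw [eC, eE, (eq_div_iff hv).2 e4, e5]
  push_cast
  field_simp

/-- `H(t+1) = R̄₂·y(n,t+1)·A₂` for partial-fraction data `d` of `H`. -/
theorem ctermH_succ (n t : ℕ) (d : ℕ → ℕ → ℚ)
    (hd : ∀ s : ℚ, (∀ p, p ≤ 3 * n + 4 → s + p + 1 ≠ 0) →
      pfEval (3 * n + 4) 7 d s = (hPolyT n).eval s / BallRivoal.poch (s + 1) (3 * n + 5) ^ 7) :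
    pfEval (3 * n + 4) 7 d ((t : ℚ) + 1) = Rbar2 n t n * (ev2 yCert n ((t : ℚ) + 1) * ev2 cA2 n t) := by
  rw [hd _ (fun p _ => by positivity), eval_hPolyT]
  set A := BallRivoal.poch ((t : ℚ) + 1) n with hAdef
  set C := BallRivoal.poch ((t : ℚ) + 2 * n + 2) n with hCdef
  set E := BallRivoal.poch ((t : ℚ) + n + 1) (n + 1) with hEdef
  have e6 : BallRivoal.poch ((t : ℚ) + 1 + 1) n * ((t : ℚ) + 1) = A * ((t : ℚ) + n + 1) := by
    have h1 := poch_succ_left ((t : ℚ) + 1) n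
    have h2 := poch_succ_right ((t : ℚ) + 1) n
    rw [← hAdef] at h2; linear_combination -h1 + h2
  have e7 : BallRivoal.poch ((t : ℚ) + 1 + (2 * n + 2)) n * ((t : ℚ) + 2 * n + 2) = C * ((t : ℚ) + 3 * n + 2) := by
    have h1 := poch_succ_left ((t : ℚ) + 2 * n + 2) n
    have h2 := poch_succ_right ((t : ℚ) + 2 * n + 2) n
    rw [← hCdef] at h2
    rw [show (t : ℚ) + 1 + (2 * n + 2) = (t : ℚ) + 2 * n + 2 + 1 by ring]
    linear_combination -h1 + h2
  have e8 : BallRivoal.poch ((t : ℚ) + 1 + (n + 1)) (n + 1) * ((t : ℚ) + n + 1) = E * ((t : ℚ) + 2 * n + 2) := by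
    have h1 := poch_succ_left ((t : ℚ) + n + 1) (n + 1)
    have h2 := poch_succ_right ((t : ℚ) + n + 1) (n + 1)
    rw [← hEdef] at h2
    rw [show (t : ℚ) + 1 + (n + 1) = (t : ℚ) + n + 1 + 1 by ring]
    push_cast at h1 h2 ⊢; linear_combination -h1 + h2
  have e9 : BallRivoal.poch ((t : ℚ) + 1 + (2 * n + 6)) n *
      (((t : ℚ) + 2 * n + 2) * ((t : ℚ) + 2 * n + 3) * ((t : ℚ) + 2 * n + 4) * ((t : ℚ) + 2 * n + 5) *
        ((t : ℚ) + 2 * n + 6)) =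
      C * (((t : ℚ) + 3 * n + 2) * ((t : ℚ) + 3 * n + 3) * ((t : ℚ) + 3 * n + 4) * ((t : ℚ) + 3 * n + 5) *
        ((t : ℚ) + 3 * n + 6)) := by
    have h := poch_split_comm ((t : ℚ) + 2 * n + 2) (a := 5) (b := n) (c := n) (d := 5) (by ring)
    rw [poch_five', poch_five', ← hCdef] at h
    rw [show (t : ℚ) + 1 + (2 * n + 6) = (t : ℚ) + 2 * n + 2 + ((5 : ℕ) : ℚ) by push_cast; ring]
    push_cast at h ⊢; linear_combination h
  have e10 : BallRivoal.poch ((t : ℚ) + 1 + 1) (3 * n + 5) * ((t : ℚ) + 1) =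
      A * E * C * (((t : ℚ) + 3 * n + 2) * ((t : ℚ) + 3 * n + 3) * ((t : ℚ) + 3 * n + 4) * ((t : ℚ) + 3 * n + 5) *
        ((t : ℚ) + 3 * n + 6)) := by
    have h1 := poch_succ_left ((t : ℚ) + 1) (3 * n + 5)
    have h2 : BallRivoal.poch ((t : ℚ) + 1) (3 * n + 5 + 1) =
        A * E * C * (((t : ℚ) + 3 * n + 2) * ((t : ℚ) + 3 * n + 3) * ((t : ℚ) + 3 * n + 4) * ((t : ℚ) + 3 * n + 5) *
        ((t : ℚ) + 3 * n + 6)) := by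
      rw [show 3 * n + 5 + 1 = (3 * n + 1) + 5 by ring, poch_add, poch_ray_split, poch_five', ← hAdef, ← hCdef, ← hEdef]
      push_cast; ring
    linear_combination -h1 + h2
  simp only [Rbar2, cA2, ev2_mul2, ev2_pow2, l111, l21, l31, l011]
  rw [← hAdef, ← hCdef, ← hEdef]
  have hA : A ≠ 0 := (poch_pos (by positivity) _).ne'
  have hC : C ≠ 0 := (poch_pos (by positivity) _).ne'
  have hE : E ≠ 0 := (poch_pos (by positivity) _).ne'
  have ht1 : ((t : ℚ) + 1) ≠ 0 := by positivity
  have hv2 : ((t : ℚ) + 2 * n + 2) ≠ 0 := by positivity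
  have hu1 : ((t : ℚ) + n + 1) ≠ 0 := by positivity
  have hv : ((t : ℚ) + 2 * n + 2) * ((t : ℚ) + 2 * n + 3) * ((t : ℚ) + 2 * n + 4) * ((t : ℚ) + 2 * n + 5) *
      ((t : ℚ) + 2 * n + 6) ≠ 0 := by positivity
  rw [(eq_div_iff ht1).2 e6, (eq_div_iff hv2).2 e7, (eq_div_iff hu1).2 e8, (eq_div_iff hv).2 e9,
    (eq_div_iff ht1).2 e10]
  push_cast
  field_simp

/-- **The contiguity identity of the ray at natural arguments**:
`κR'_n(t) − αR_n(t) − βR_{n+1}(t) − γR_{n+2}(t) + H(t) − H(t+1) = 0` for partial-fraction data `d` of `H`. -/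
theorem contig_identity_ray (n t : ℕ) (d : ℕ → ℕ → ℚ)
    (hd : ∀ s : ℚ, (∀ p, p ≤ 3 * n + 4 → s + p + 1 ≠ 0) →
      pfEval (3 * n + 4) 7 d s = (hPolyT n).eval s / BallRivoal.poch (s + 1) (3 * n + 5) ^ 7) :
    ev1 symKa n * pfEval (3 * n) 6 (pfData (bRay' n)) t - ev1 symAl n * pfEval (3 * n) 6 (pfData (bRay n)) t
      - ev1 symBe n * pfEval (3 * (n + 1)) 6 (pfData (bRay (n + 1))) t
      - ev1 symGa n * pfEval (3 * (n + 2)) 6 (pfData (bRay (n + 2))) t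
      + pfEval (3 * n + 4) 7 d t - pfEval (3 * n + 4) 7 d ((t : ℚ) + 1) = 0 := by
  rw [ctermP, cterm0, cterm1, cterm2, ctermH n t d hd, ctermH_succ n t d hd]
  linear_combination (Rbar2 n t n) * gosper_contig_symray n t

end Summit.KontsevichZagierPeriods.Zeta5Search.SymRay
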